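import Summits.QuantumFields.YangMills.Theorems.CentreWallReflectionSlabOdd2
import Summits.QuantumFields.YangMills.Theses.CentreWallReflection
import HarnessLib

/-!
# Crux `CentreWallReflection.WallReflection` ⟨stmt-QuantumFields-23707⟩ — CLOSED: `stub_instantiate` and the crux BY NAME
# (crux `CentreWallReflection.WallReflection` ⟨stmt-QuantumFields-23707⟩, line `birth`, stub `stub_instantiate`; planner ym-idea-4 g18)

`stub_instantiate : EvenRingP → OddRingP → Goal` (registered stub 3 of the birth skeleton; the lattice instantiation: parity split into `core_even` /
`core_odd` of the slab modules, binders of the route statement unpacked: `n := L`, slicing direction `q₁`, Polyakov direction `q₂`,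
`s₀ := δ/(L+1)²`, the inline `Z`-device = `twistedCost`, second countability of `G` from the faithful `r`) and
`wallReflection_proof : Theses.CentreWallReflection.WallReflection := stub_instantiate stub_evenRing stub_oddRing`.
HONEST FRAMING: lattice bookkeeping toward ONE crux of a draft route (fixed torus, finite lattice); nothing here proves the route's target
`MarginalTwistOnset.FixedTorusCriterionFailure`, any continuum statement, or the Yang–Mills mass gap.  THEOREMS ONLY (no `def`, no `sorry`),
standard axioms.  References: [cite: OsterwalderSeiler1978, §2]; [cite: tHooft1979]; E. T. Tomboulis, L. G. Yaffe, CMP 100 (1985) 313;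
[cite: Luscher1983, §2].
-/

set_option autoImplicit false

noncomputable section

open scoped BigOperators
open MeasureTheory Literature.MathematicalPhysics.QuantumFieldTheory

namespace Summit.QuantumFields.YangMills.Theorems.CentreWallReflection

open MeasureTheory
open Literature.MathematicalPhysics.QuantumFieldTheory
open Summit.QuantumFields.YangMills.Theorems.CentreWallReflection.Slab

/-- ★★★ **`stub_instantiate`** (registered stub 3 of the birth skeleton of crux ⟨stmt-QuantumFields-23707⟩, signature `EvenRingP → OddRingP → Goal`,
`Goal` the skeleton's abbreviation of the route declaration, spelled out here): THE LATTICE INSTANTIATION — slice the `(L+1)⁴` torus normal to `μ = q₁`; the slab kernels `Ψ_j` (boundary slices glued in, interior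
integrated out; symmetric by the slab reflection; `Ψ_{m+1} = Ψ_1 ∗ Ψ_m`), the centre twist `T` on the slice-`0` stack (`P_ν(TX) = z P_ν(X)`), the
label `O ∘ P_ν`, the wall event `{P_ν ∈ W}`, the close pairs `{∃ u, N − Re tr ρ(P(a)⁻¹ u P(a') u⁻¹) < δ}`; the one-layer kernel is positive
semi-definite (Osterwalder–Seiler, Gram form, gauge averaging); the ring weights are the torus weights (ring identities); a label change between
slices costs a wall or a pinned ladder plaquette (lattice Stokes); pinned plaquettes and bad bonds are absolutely `≤ e^{−βδ/(L+1)²}`; even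
tori `≤ 5εZ(1)`, odd tori `≤ 8εZ(1)`, filed constant `16`. -/
theorem stub_instantiate :
    EvenRingP → OddRingP → Summit.QuantumFields.YangMills.Theses.CentreWallReflection.WallReflection := by
  intro hE hO G _ _ _ _ _hG
  letI : MeasurableSpace G := borel G
  haveI : BorelSpace G := ⟨rfl⟩
  intro r Z hZ L hL z hz q O Wset δ ε hOm hWm hOc hWc hsep hδ hloc hε hε1
  -- second countability of `G` from the faithful representation
  haveI : SecondCountableTopology (Matrix (Fin r.N) (Fin r.N) ℂ) :=
    inferInstanceAs (SecondCountableTopology (Fin r.N → Fin r.N → ℂ))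
  haveI : SecondCountableTopology G := (r.continuous.isClosedEmbedding r.injective).isEmbedding.secondCountableTopology
  refine ⟨δ / (((L + 1 : ℕ) : ℝ) ^ 2), by positivity, fun β hβ hwall hpin => ?_⟩
  -- the two partition functions in slab language
  have hZz : Z β (L + 1) z q = ∫ W, Real.exp (-(β * ∑ p : Plaquette 4 (L + 1), twistedCost r.ρ q z W p))
      ∂(Measure.pi fun _ : Edge 4 (L + 1) => haarProbability G) := by
    rw [hZ]; rfl
  have hZ1 : Z β (L + 1) 1 q = ∫ W, boltz r.ρ β W ∂(Measure.pi fun _ : Edge 4 (L + 1) => haarProbability G) := by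
    rw [hZ]
    refine integral_congr_ae (ae_of_all _ fun U => ?_)
    simp only [boltz, plaqCost, ite_self, one_mul]
  -- the wall weights
  have hwall' : ∑ t ∈ Finset.range (L + 1), wallWeight (n := L) r.ρ q.1.1 q.1.2 β Wset t ≤
      ε ^ 2 * ∫ W, boltz r.ρ β W ∂(Measure.pi fun _ : Edge 4 (L + 1) => haarProbability G) := by
    rw [Finset.sum_range, ← hZ1]
    have e : ∀ t : Fin (L + 1), wallWeight (n := L) r.ρ q.1.1 q.1.2 β Wset (t : ℕ) =
        ∫ U : GaugeConfig 4 (L + 1) G, Wset.indicator (fun _ => (1 : ℝ))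
          (lineHolonomy U q.1.2 (L + 1) (fun i => if i = q.1.1 then ((t : ℕ) : ZMod (L + 1)) else 0)) *
          Real.exp (-(β * ∑ p : Plaquette 4 (L + 1), ((r.N : ℝ) - (r.ρ (plaquetteHolonomy U p.1 p.2.1.1 p.2.1.2)).trace.re)))
          ∂(Measure.pi fun _ : Edge 4 (L + 1) => haarProbability G) := fun t => rfl
    simp only [e]
    exact hwall
  have hpin' : (((L + 1 : ℕ) : ℝ) ^ 2) * Real.exp (-((δ / (((L + 1 : ℕ) : ℝ) ^ 2)) * β)) ≤
      ε ^ 2 * ∫ W, boltz r.ρ β W ∂(Measure.pi fun _ : Edge 4 (L + 1) => haarProbability G) := by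
    rw [← hZ1]; exact hpin
  rw [hZz, hZ1]
  -- parity of the torus side
  rcases Nat.even_or_odd (L + 1) with ⟨m, hm⟩ | ⟨m, hm⟩
  · exact core_even r.ρ q.1.1 q.1.2 hE hL (m := m) (by omega) r.continuous r.mem_unitary (q := q) rfl rfl hz hOm hWm hOc hWc hsep
      hloc hε hβ hwall' hpin'
  · exact core_odd r.ρ q.1.1 q.1.2 hO hL (m := m) (by omega) r.continuous r.mem_unitary (q := q) rfl rfl hz hOm hWm hOc hWc hsep
      hloc hε hε1 hβ hwall' hpin'

/-- ★★★ **`CentreWallReflection.WallReflection`** ⟨stmt-QuantumFields-23707⟩ (crux r3 of LINE g18-A, planner ym-idea-4 g18), BY NAME: for every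
compact simple `G`, faithful unitary `r`, inline twisted partition function `Z`, torus side `L + 1 ≥ 2`, central `z`, plane `q`, admissible wall
datum `(O, W, δ)` and `0 < ε ≤ 1`, with `s₀ = δ/(L+1)²`: for every `β ≥ 0`, if `N_W(β) ≤ ε²Z(β,1)` and `(L+1)²e^{−s₀β} ≤ ε²Z(β,1)` then
`Z(β,z) ≤ 16εZ(β,1)` — from the registered stubs `stub_evenRing`, `stub_oddRing` (landed) and `stub_instantiate`.  HONEST FRAMING: a fixed-torus
finite-lattice inequality; the deciding crux `NegligibleWalls` ⟨23706⟩ of the route, its target `MarginalTwistOnset.FixedTorusCriterionFailure`,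
every continuum statement and the Yang–Mills mass gap remain OPEN / NOT proved. [cite: OsterwalderSeiler1978, §2] [cite: tHooft1979] -/
theorem wallReflection_proof : Summit.QuantumFields.YangMills.Theses.CentreWallReflection.WallReflection :=
  stub_instantiate stub_evenRing stub_oddRing

end Summit.QuantumFields.YangMills.Theorems.CentreWallReflection

end
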